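import Summits.Parity.GeneralizedHardyLittlewood.Theses.LiouvilleShiftedTables
import Summits.Parity.GeneralizedHardyLittlewood.Theorems.TableChowla.Negative.TableChowlaExceptionalSet

/-!
# `TableChowla` (stmt-Parity-14270): band domination by a finite van der Corput inequality, and
# the band reduction `NearDiagonalChowla → TableChowla`

Support lemmas for the crux `LiouvilleShiftedTables.TableChowla` (cdisprove seat):
* `vdC_pointwise` — finite van der Corput with window-overlap weights:
  `H²(Σ_{a∈I} u a)² ≤ |M|·Σ_{a,a'∈I} u a·u a'·#{m ∈ M : m ∈ [a,a+H) ∩ [a',a'+H)}`;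
* `vdC_momentN` — BAND DOMINATION of the fourth moment: `H·T ≤ (A₂ + H − 1 − A₁)·T_band(H)` for
  every `H ≥ 1`, where `bandMomentN … H` keeps only the row pairs at distance `< H`;
* `bandMomentN_le_diag_add_slopes` — symmetric split `T_band(H) ≤ diag + 2Σ_a Σ_{1≤h<H} S(a,a+h)²`;
* `tableChowla_of_bandBound`, `tableChowla_of_nearDiagonal` — hence the whole `(log x)^{-C}` claim
  of the crux is carried by the `≍ A·(log x)^{C+2}` near-diagonal row pairs: a `(log x)^{K-1}`
  mean-square saving on the band of width `(log x)^K` for every `K` (`NearDiagonalChowla`, the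
  rows-restricted form of the transfer target of crux idea `slope-band-vdc`) implies the crux.
[folklore]
-/

namespace Summit.Parity.GeneralizedHardyLittlewood.Theorems.TableChowla.Negative

open Finset Real ArithmeticFunction
open Summit.Parity.GeneralizedHardyLittlewood.Theses

noncomputable section

variable {I M : Finset ℕ} {H : ℕ}

/-- A full window `[a, a+H)` inside `M` has exactly `H` points. -/
theorem card_window_eq {a : ℕ} (haM : ∀ m, a ≤ m → m < a + H → m ∈ M) :
    (M.filter (fun m => a ≤ m ∧ m < a + H)).card = H := by
  have : M.filter (fun m => a ≤ m ∧ m < a + H) = Finset.Ico a (a + H) := by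
    ext m
    simp only [mem_filter, Finset.mem_Ico]
    constructor
    · rintro ⟨_, h1, h2⟩; exact ⟨h1, h2⟩
    · rintro ⟨h1, h2⟩; exact ⟨haM m h1 h2, h1, h2⟩
  rw [this, Nat.card_Ico]
  omega

/-- POINTWISE van der Corput with window-overlap weights
`w(a,a') = #{m ∈ M : m ∈ [a,a+H) ∩ [a',a'+H)}`:
`H² (Σ_{a∈I} u a)² ≤ |M| · Σ_{a,a'∈I} u a · u a' · w(a,a')`, whenever every window of `I` lies in `M`. -/
theorem vdC_pointwise (u : ℕ → ℝ) (hIM : ∀ a ∈ I, ∀ m, a ≤ m → m < a + H → m ∈ M) :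
    (H : ℝ) ^ 2 * (∑ a ∈ I, u a) ^ 2 ≤ (M.card : ℝ) * ∑ a ∈ I, ∑ a' ∈ I,
      u a * u a' * ((M.filter (fun m => (a ≤ m ∧ m < a + H) ∧ (a' ≤ m ∧ m < a' + H))).card : ℝ) := by
  set W : ℕ → ℝ := fun m => ∑ a ∈ I, if a ≤ m ∧ m < a + H then u a else 0 with hW
  have hsum : ∑ m ∈ M, W m = H * ∑ a ∈ I, u a := by
    simp only [hW]
    rw [sum_comm, mul_sum]
    refine sum_congr rfl fun a ha => ?_
    rw [← sum_filter, sum_const, nsmul_eq_mul, card_window_eq (hIM a ha)]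
  have hsq : ∑ m ∈ M, W m ^ 2 = ∑ a ∈ I, ∑ a' ∈ I,
      u a * u a' * ((M.filter (fun m => (a ≤ m ∧ m < a + H) ∧ (a' ≤ m ∧ m < a' + H))).card : ℝ) := by
    simp only [hW]
    simp_rw [sq, sum_mul_sum]
    rw [sum_comm]
    refine sum_congr rfl fun a _ => ?_
    rw [sum_comm]
    refine sum_congr rfl fun a' _ => ?_
    simp_rw [ite_zero_mul_ite_zero]
    rw [← sum_filter, sum_const, nsmul_eq_mul]
    ring
  have hcs : (∑ m ∈ M, W m) ^ 2 ≤ (M.card : ℝ) * ∑ m ∈ M, W m ^ 2 := by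
    have := sum_mul_sq_le_sq_mul_sq M (fun _ => (1 : ℝ)) W
    simpa using this
  calc (H : ℝ) ^ 2 * (∑ a ∈ I, u a) ^ 2 = (∑ m ∈ M, W m) ^ 2 := by rw [hsum]; ring
    _ ≤ (M.card : ℝ) * ∑ m ∈ M, W m ^ 2 := hcs
    _ = _ := by rw [hsq]

/-- The overlap weight vanishes off the band `|a − a'| < H` … -/
theorem card_overlap_eq_zero {a a' : ℕ} (h : ¬ (a' < a + H ∧ a < a' + H)) :
    (M.filter (fun m => (a ≤ m ∧ m < a + H) ∧ (a' ≤ m ∧ m < a' + H))).card = 0 := by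
  rw [Finset.card_eq_zero, Finset.filter_eq_empty_iff]
  intro m _ hm
  apply h
  omega

/-- … and is at most `H` on it. -/
theorem card_overlap_le {a a' : ℕ} (haM : ∀ m, a ≤ m → m < a + H → m ∈ M) :
    (M.filter (fun m => (a ≤ m ∧ m < a + H) ∧ (a' ≤ m ∧ m < a' + H))).card ≤ H := by
  calc (M.filter (fun m => (a ≤ m ∧ m < a + H) ∧ (a' ≤ m ∧ m < a' + H))).card
      ≤ (M.filter (fun m => a ≤ m ∧ m < a + H)).card := by
        apply card_le_card
        intro m hm
        simp only [mem_filter] at hm ⊢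
        exact ⟨hm.1, hm.2.1⟩
    _ = H := card_window_eq haM

/-- BAND fourth moment: only row pairs at distance `< H` (diagonal included). -/
def bandMomentN (f : ℕ → ℝ) (c : ℤ) (A₁ A₂ B H : ℕ) : ℝ :=
  ∑ a ∈ Ioc A₁ A₂, ∑ a' ∈ (Ioc A₁ A₂).filter (fun a' => a' < a + H ∧ a < a' + H),
    rowCorr f c B a a' ^ 2

variable {f : ℕ → ℝ} {c : ℤ} {A₁ A₂ B : ℕ}

/-- **BAND DOMINATION** (van der Corput across the rows, summed over column pairs):
`H · T ≤ (A₂ + H − 1 − A₁) · T_band(H)` for every `H ≥ 1`. -/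
theorem vdC_momentN {H : ℕ} (hH : 1 ≤ H) :
    (H : ℝ) * momentN f c A₁ A₂ B ≤ ((A₂ + H - 1 - A₁ : ℕ) : ℝ) * bandMomentN f c A₁ A₂ B H := by
  set I : Finset ℕ := Ioc A₁ A₂ with hI
  set M : Finset ℕ := Icc (A₁ + 1) (A₂ + H - 1) with hM
  have hIM : ∀ a ∈ I, ∀ m, a ≤ m → m < a + H → m ∈ M := by
    intro a ha m h1 h2
    rw [hI, mem_Ioc] at ha
    rw [hM, mem_Icc]
    omega
  have hMcard : (M.card : ℝ) = ((A₂ + H - 1 - A₁ : ℕ) : ℝ) := by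
    rw [hM, Nat.card_Icc]
    congr 1
    omega
  set e : ℕ → ℕ → ℝ := fun a b => f (Int.toNat ((a : ℤ) * b + c)) with he
  set w : ℕ → ℕ → ℝ := fun a a' =>
    ((M.filter (fun m => (a ≤ m ∧ m < a + H) ∧ (a' ≤ m ∧ m < a' + H))).card : ℝ) with hw
  -- Step 1: H² T ≤ |M| Σ_{a,a'} w(a,a') S(a,a')²
  have step1 : (H : ℝ) ^ 2 * momentN f c A₁ A₂ B ≤
      (M.card : ℝ) * ∑ a ∈ I, ∑ a' ∈ I, w a a' * rowCorr f c B a a' ^ 2 := by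
    have hpt : ∀ b b' : ℕ, (H : ℝ) ^ 2 * (∑ a ∈ I, e a b * e a b') ^ 2 ≤
        (M.card : ℝ) * ∑ a ∈ I, ∑ a' ∈ I, (e a b * e a b') * (e a' b * e a' b') * w a a' :=
      fun b b' => vdC_pointwise (fun a => e a b * e a b') hIM
    have hT : momentN f c A₁ A₂ B = ∑ b ∈ Icc 1 B, ∑ b' ∈ Icc 1 B, (∑ a ∈ I, e a b * e a b') ^ 2 := by
      rw [momentN_eq_colMoment]
    rw [hT, mul_sum]
    simp_rw [mul_sum (s := Icc 1 B) (a := (H : ℝ) ^ 2)]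
    calc ∑ b ∈ Icc 1 B, ∑ b' ∈ Icc 1 B, (H : ℝ) ^ 2 * (∑ a ∈ I, e a b * e a b') ^ 2
        ≤ ∑ b ∈ Icc 1 B, ∑ b' ∈ Icc 1 B,
            (M.card : ℝ) * ∑ a ∈ I, ∑ a' ∈ I, (e a b * e a b') * (e a' b * e a' b') * w a a' :=
          sum_le_sum fun b _ => sum_le_sum fun b' _ => hpt b b'
      _ = (M.card : ℝ) * ∑ a ∈ I, ∑ a' ∈ I, w a a' * rowCorr f c B a a' ^ 2 := by
          rw [mul_sum]
          simp_rw [mul_sum (a := (M.card : ℝ))]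
          -- bubble the row sums (over I) outside the column sums (over Icc 1 B)
          simp_rw [sum_comm (s := Icc 1 B) (t := I)]
          refine sum_congr rfl fun a _ => sum_congr rfl fun a' _ => ?_
          simp_rw [← mul_sum]
          congr 1
          unfold rowCorr
          rw [sq, sum_mul_sum, mul_sum]
          refine sum_congr rfl fun b _ => ?_
          rw [mul_sum]
          refine sum_congr rfl fun b' _ => ?_
          simp only [he]
          ring
  -- Step 2: Σ_{a,a'} w S² ≤ H · T_band(H)
  have step2 : ∑ a ∈ I, ∑ a' ∈ I, w a a' * rowCorr f c B a a' ^ 2 ≤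
      (H : ℝ) * bandMomentN f c A₁ A₂ B H := by
    unfold bandMomentN
    rw [← hI, mul_sum]
    refine sum_le_sum fun a ha => ?_
    rw [mul_sum, ← sum_filter_add_sum_filter_not I (fun a' => a' < a + H ∧ a < a' + H)]
    have hzero : ∑ a' ∈ I.filter (fun a' => ¬ (a' < a + H ∧ a < a' + H)),
        w a a' * rowCorr f c B a a' ^ 2 = 0 := by
      refine sum_eq_zero fun a' ha' => ?_
      have hna := (mem_filter.mp ha').2
      simp only [hw, card_overlap_eq_zero hna, Nat.cast_zero, zero_mul]
    rw [hzero, add_zero]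
    refine sum_le_sum fun a' _ => ?_
    have hwle : w a a' ≤ H := by
      simp only [hw]
      exact_mod_cast card_overlap_le (hIM a ha)
    exact mul_le_mul_of_nonneg_right hwle (sq_nonneg _)
  -- combine: H² T ≤ |M| H T_band, divide by H
  have hHpos : (0 : ℝ) < H := by exact_mod_cast hH
  have hcomb : (H : ℝ) ^ 2 * momentN f c A₁ A₂ B ≤ (H : ℝ) * (((A₂ + H - 1 - A₁ : ℕ) : ℝ) * bandMomentN f c A₁ A₂ B H) := by
    calc (H : ℝ) ^ 2 * momentN f c A₁ A₂ B
        ≤ (M.card : ℝ) * ∑ a ∈ I, ∑ a' ∈ I, w a a' * rowCorr f c B a a' ^ 2 := step1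
      _ ≤ (M.card : ℝ) * ((H : ℝ) * bandMomentN f c A₁ A₂ B H) :=
          mul_le_mul_of_nonneg_left step2 (Nat.cast_nonneg _)
      _ = (H : ℝ) * (((A₂ + H - 1 - A₁ : ℕ) : ℝ) * bandMomentN f c A₁ A₂ B H) := by rw [hMcard]; ring
  rw [sq, mul_assoc] at hcomb
  exact le_of_mul_le_mul_left hcomb hHpos

/-- NEAR-DIAGONAL CHOWLA (rows-restricted symmetric band, diagonal included, the card's budget
`x² log x / A`): `T_band((log x)^K) ≤ x² log x / A` for every `K`. The card's `BandChowla`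
(one-sided slopes `h ∈ [1,(log x)^K]`, `a + h` allowed beyond the rows) implies it up to the
harmless factor `rows·B² + 2·band ≤ 4x² log x/A` by the symmetry `S(a,a') = S(a',a)` (paper). -/
def NearDiagonalChowla : Prop :=
  ∀ c : ℤ, c ≠ 0 → ∀ δ : ℝ, 0 < δ → δ ≤ 1 / 12 → ∀ K : ℝ, 0 < K → ∃ x₀ : ℝ, ∀ x : ℝ, x₀ ≤ x →
    ∀ A : ℝ, x ^ δ ≤ A → A ≤ x ^ (1 / 3 + δ) →
      bandMomentN lam c ⌊A⌋₊ ⌊2 * A⌋₊ ⌊x / A⌋₊ ⌊Real.log x ^ K⌋₊ ≤ x ^ 2 * Real.log x / A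

/-- **BAND REDUCTION, general form**: if for every `K` the band moment at width
`H = ⌊(log x)^K⌋ + s` (`s ≤ 1`) is eventually `≤ M·x² log x/A` in the window, then `TableChowla`
(take `K = C + 2`: band domination gives `T ≤ ((rows + H − 1)/H)·M x² log x/A ≤ 6M x²/(log x)^{C+1}`). -/
theorem tableChowla_of_bandBound {M : ℝ} (hM : 1 ≤ M) {s : ℕ} (hs : s ≤ 1)
    (h : ∀ c : ℤ, c ≠ 0 → ∀ δ : ℝ, 0 < δ → δ ≤ 1 / 12 → ∀ K : ℝ, 0 < K → ∃ x₀ : ℝ, ∀ x : ℝ, x₀ ≤ x →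
      ∀ A : ℝ, x ^ δ ≤ A → A ≤ x ^ (1 / 3 + δ) →
        bandMomentN lam c ⌊A⌋₊ ⌊2 * A⌋₊ ⌊x / A⌋₊ (⌊Real.log x ^ K⌋₊ + s) ≤ M * x ^ 2 * Real.log x / A) :
    LiouvilleShiftedTables.TableChowla := by
  rw [tableChowla_iff]
  intro c hc δ hδ hδ' C hC
  obtain ⟨x₀, hx₀⟩ := h c hc δ hδ hδ' (C + 2) (by linarith)
  obtain ⟨X₁, hX₁⟩ := eventually_log_rpow_le hδ (C + 2)
  refine ⟨max (max x₀ 1) (max X₁ (Real.exp (6 * M))), fun x hx A hA hA' => ?_⟩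
  have hx₀x : x₀ ≤ x := le_trans (le_trans (le_max_left _ _) (le_max_left _ _)) hx
  have hx1 : 1 ≤ x := le_trans (le_trans (le_max_right _ _) (le_max_left _ _)) hx
  have hxX₁ : X₁ ≤ x := le_trans (le_trans (le_max_left _ _) (le_max_right _ _)) hx
  have hxe : Real.exp (6 * M) ≤ x := le_trans (le_trans (le_max_right _ _) (le_max_right _ _)) hx
  have hxpos : 0 < x := by linarith
  have hlog6 : 6 * M ≤ Real.log x := (Real.le_log_iff_exp_le hxpos).mpr hxe
  have hlogpos : 0 < Real.log x := by nlinarith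
  obtain ⟨h4, _⟩ := hX₁ x hxX₁
  have hAone : 1 ≤ A := le_trans (Real.one_le_rpow hx1 hδ.le) hA
  have hApos : 0 < A := by linarith
  set Lr : ℝ := Real.log x ^ (C + 2) with hLr
  have hLr6 : 6 ≤ Lr := by
    calc (6 : ℝ) ≤ Real.log x := by nlinarith
      _ = Real.log x ^ (1 : ℝ) := (Real.rpow_one _).symm
      _ ≤ Lr := by rw [hLr]; exact Real.rpow_le_rpow_of_exponent_le (by nlinarith) (by linarith)
  set H : ℕ := ⌊Lr⌋₊ + s with hHdef
  have hH1 : 1 ≤ H := by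
    have : 1 ≤ ⌊Lr⌋₊ := by rw [Nat.one_le_floor_iff]; linarith
    omega
  have hfl : (⌊Lr⌋₊ : ℝ) ≤ Lr := Nat.floor_le (by linarith)
  have hHle : (H : ℝ) ≤ Lr + 1 := by
    rw [hHdef]; push_cast
    have : (s : ℝ) ≤ 1 := by exact_mod_cast hs
    linarith
  have hHge : Lr / 2 ≤ H := by
    have := Nat.lt_floor_add_one Lr
    rw [hHdef]; push_cast
    have : (0 : ℝ) ≤ s := Nat.cast_nonneg s
    linarith
  have hHpos : (0 : ℝ) < H := by exact_mod_cast hH1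
  have hLrA : Lr ≤ A := by linarith
  have hband := hx₀ x hx₀x A hA hA'
  rw [← hLr, ← hHdef] at hband
  have hvdc := vdC_momentN (f := lam) (c := c) (A₁ := ⌊A⌋₊) (A₂ := ⌊2 * A⌋₊) (B := ⌊x / A⌋₊) hH1
  have hrows : ((⌊2 * A⌋₊ + H - 1 - ⌊A⌋₊ : ℕ) : ℝ) ≤ 3 * A := by
    have h1 : (⌊2 * A⌋₊ : ℝ) ≤ 2 * A := Nat.floor_le (by linarith)
    have h2 : ((⌊2 * A⌋₊ + H - 1 - ⌊A⌋₊ : ℕ) : ℝ) ≤ ((⌊2 * A⌋₊ + H - 1 : ℕ) : ℝ) := by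
      exact_mod_cast (show ⌊2 * A⌋₊ + H - 1 - ⌊A⌋₊ ≤ ⌊2 * A⌋₊ + H - 1 by omega)
    have h3 : ((⌊2 * A⌋₊ + H - 1 : ℕ) : ℝ) = (⌊2 * A⌋₊ : ℝ) + H - 1 := by
      rw [Nat.cast_sub (by omega)]; push_cast; ring
    rw [h3] at h2
    linarith
  have hbandnn : 0 ≤ bandMomentN lam c ⌊A⌋₊ ⌊2 * A⌋₊ ⌊x / A⌋₊ H :=
    sum_nonneg fun _ _ => sum_nonneg fun _ _ => sq_nonneg _
  have hHT : (H : ℝ) * momentN lam c ⌊A⌋₊ ⌊2 * A⌋₊ ⌊x / A⌋₊ ≤ 3 * M * x ^ 2 * Real.log x := by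
    calc (H : ℝ) * momentN lam c ⌊A⌋₊ ⌊2 * A⌋₊ ⌊x / A⌋₊
        ≤ ((⌊2 * A⌋₊ + H - 1 - ⌊A⌋₊ : ℕ) : ℝ) * bandMomentN lam c ⌊A⌋₊ ⌊2 * A⌋₊ ⌊x / A⌋₊ H := hvdc
      _ ≤ (3 * A) * (M * x ^ 2 * Real.log x / A) := mul_le_mul hrows hband hbandnn (by positivity)
      _ = 3 * M * x ^ 2 * Real.log x := by field_simp
  have hsplit : Lr = Real.log x ^ C * Real.log x ^ 2 := by
    rw [hLr, Real.rpow_add hlogpos, Real.rpow_two]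
  show momentN lam c ⌊A⌋₊ ⌊2 * A⌋₊ ⌊x / A⌋₊ ≤ x ^ 2 / Real.log x ^ C
  have hLpos : 0 < Real.log x ^ C := Real.rpow_pos_of_pos hlogpos C
  rw [le_div_iff₀ hLpos]
  have hT0 : 0 ≤ momentN lam c ⌊A⌋₊ ⌊2 * A⌋₊ ⌊x / A⌋₊ := momentN_nonneg
  have h1 : Lr * momentN lam c ⌊A⌋₊ ⌊2 * A⌋₊ ⌊x / A⌋₊ ≤ 6 * M * x ^ 2 * Real.log x := by
    nlinarith [mul_le_mul_of_nonneg_right hHge hT0]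
  rw [hsplit] at h1
  have hl2 : 0 < Real.log x ^ 2 := by positivity
  have h2 : momentN lam c ⌊A⌋₊ ⌊2 * A⌋₊ ⌊x / A⌋₊ * Real.log x ^ C * Real.log x ^ 2 ≤
      x ^ 2 * Real.log x ^ 2 := by
    have hx2l : (0 : ℝ) ≤ x ^ 2 * Real.log x := by positivity
    calc momentN lam c ⌊A⌋₊ ⌊2 * A⌋₊ ⌊x / A⌋₊ * Real.log x ^ C * Real.log x ^ 2
        = Real.log x ^ C * Real.log x ^ 2 * momentN lam c ⌊A⌋₊ ⌊2 * A⌋₊ ⌊x / A⌋₊ := by ring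
      _ ≤ 6 * M * x ^ 2 * Real.log x := h1
      _ = (6 * M) * (x ^ 2 * Real.log x) := by ring
      _ ≤ Real.log x * (x ^ 2 * Real.log x) := mul_le_mul_of_nonneg_right hlog6 hx2l
      _ = x ^ 2 * Real.log x ^ 2 := by ring
  exact le_of_mul_le_mul_right h2 hl2

/-- **BAND REDUCTION, PROVED**: `NearDiagonalChowla → TableChowla`. -/
theorem tableChowla_of_nearDiagonal (h : NearDiagonalChowla) : LiouvilleShiftedTables.TableChowla :=
  tableChowla_of_bandBound (M := 1) le_rfl (s := 0) (by norm_num) fun c hc δ hδ hδ' K hK => by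
    obtain ⟨x₀, hx₀⟩ := h c hc δ hδ hδ' K hK
    exact ⟨x₀, fun x hx A hA hA' => by rw [add_zero, one_mul]; exact hx₀ x hx A hA hA'⟩

/-- Symmetry of the row correlations. -/
theorem rowCorr_comm (a a' : ℕ) : rowCorr f c B a a' = rowCorr f c B a' a := by
  unfold rowCorr
  exact sum_congr rfl fun b _ => mul_comm _ _

/-- SYMMETRIC SPLIT of the band: `T_band(H) ≤ diagonal + 2·Σ_{a} Σ_{1 ≤ h ≤ H−1} S(a,a+h)²`
(the one-sided slope sums of card `slope-band-vdc`, with `a + h` allowed beyond the rows). -/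
theorem bandMomentN_le_diag_add_slopes (H : ℕ) :
    bandMomentN f c A₁ A₂ B H ≤ ∑ a ∈ Ioc A₁ A₂, rowCorr f c B a a ^ 2 +
      2 * ∑ a ∈ Ioc A₁ A₂, ∑ h ∈ Icc 1 (H - 1), rowCorr f c B a (a + h) ^ 2 := by
  classical
  set I : Finset ℕ := Ioc A₁ A₂ with hI
  set g : ℕ → ℕ → ℝ := fun a a' => rowCorr f c B a a' ^ 2 with hg
  have hg0 : ∀ a a', 0 ≤ g a a' := fun _ _ => sq_nonneg _
  have hgsymm : ∀ a a', g a a' = g a' a := fun a a' => by simp only [hg, rowCorr_comm a a']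
  -- one-sided sums U a := Σ_{a' ∈ I, a < a' < a + H} g a a'
  set U : ℕ → ℝ := fun a => ∑ a' ∈ I.filter (fun a' => a < a' ∧ a' < a + H), g a a' with hU
  -- (1) pointwise split of the band filter into  {a'} ∪ {a < a'} ∪ {a' < a}
  have hsplit : ∀ a ∈ I, ∑ a' ∈ I.filter (fun a' => a' < a + H ∧ a < a' + H), g a a' ≤
      g a a + U a + ∑ a' ∈ I.filter (fun a' => a' < a ∧ a < a' + H), g a a' := by
    intro a ha
    simp only [hU]
    rw [sum_filter, sum_filter, sum_filter]
    have hdiag : g a a = ∑ a' ∈ I, if a' = a then g a a' else 0 := by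
      rw [Finset.sum_ite_eq', if_pos ha]
    rw [hdiag, ← sum_add_distrib, ← sum_add_distrib]
    refine sum_le_sum fun a' _ => ?_
    have h0 := hg0 a a'
    split_ifs <;> first | linarith | (exfalso; omega)
  -- (2) the `a' < a` part, summed over a, equals Σ_a U a (swap the names, use symmetry)
  have hswap : ∑ a ∈ I, ∑ a' ∈ I.filter (fun a' => a' < a ∧ a < a' + H), g a a' = ∑ a ∈ I, U a := by
    simp only [hU, sum_filter]
    rw [sum_comm]
    refine sum_congr rfl fun a _ => sum_congr rfl fun a' _ => ?_
    by_cases hP : a < a' ∧ a' < a + H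
    · rw [if_pos hP, if_pos ⟨hP.1, hP.2⟩, hgsymm]
    · rw [if_neg hP, if_neg (fun h => hP ⟨h.1, h.2⟩)]
  -- (3) U a ≤ Σ_{h ∈ [1,H-1]} g a (a+h)  (reindex a' = a + h)
  have hUle : ∀ a, U a ≤ ∑ h ∈ Icc 1 (H - 1), g a (a + h) := by
    intro a
    have hinj : Set.InjOn (fun h => a + h) (Icc 1 (H - 1) : Finset ℕ) := fun h _ h' _ hh => by
      simpa using hh
    rw [← sum_image hinj]
    refine sum_le_sum_of_subset_of_nonneg ?_ fun _ _ _ => hg0 _ _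
    intro a' ha'
    simp only [mem_filter] at ha'
    rw [mem_image]
    refine ⟨a' - a, ?_, ?_⟩
    · rw [mem_Icc]; omega
    · omega
  -- assemble
  calc bandMomentN f c A₁ A₂ B H
      = ∑ a ∈ I, ∑ a' ∈ I.filter (fun a' => a' < a + H ∧ a < a' + H), g a a' := by
        simp only [bandMomentN, hI, hg]
    _ ≤ ∑ a ∈ I, (g a a + U a + ∑ a' ∈ I.filter (fun a' => a' < a ∧ a < a' + H), g a a') :=
        sum_le_sum hsplit
    _ = ∑ a ∈ I, g a a + ∑ a ∈ I, U a + ∑ a ∈ I, U a := by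
        rw [sum_add_distrib, sum_add_distrib, hswap]
    _ ≤ ∑ a ∈ I, g a a + 2 * ∑ a ∈ I, ∑ h ∈ Icc 1 (H - 1), g a (a + h) := by
        have := sum_le_sum fun a (_ : a ∈ I) => hUle a
        linarith

end

end Summit.Parity.GeneralizedHardyLittlewood.Theorems.TableChowla.Negative
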